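/-
Copyright: b2b-lace packet (LEAN TYPING SEAT 1, gen 20; unit `b2b-lace-lean1-g20`).  N67-S3 part 1b of `LEMMAS.md` §24
(census D10H-3): the LIVE end-point classes of the explicit pieces — a `d`-generic, kernel-evaluable enumeration of
the classes on which the `i`-step self-avoiding-walk count does not vanish, and the re-indexing of the class sums of
`WeightedBubbleExplicitPieces` / `SawEndpointClasses` by it.  Pure combinatorics; no numeral, no dimension, no named
fact, nothing of the record touched.  WHAT-IF / input-certification lane: pointer language only; no dimension sentence.
-/
import Literature.Probability.FitznerVanDerHofstad2017.WeightedBubbleExplicitPieces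
import Literature.Probability.FitznerVanDerHofstad2017.LatticePointClassesRegroup
import Literature.Probability.FitznerVanDerHofstad2017.SawCountRecursion
import HarnessLib

/-!
# Live end-point classes of the explicit pieces ([NoBLE17-I] §5.3.3, the sum over `x ∈ ℤ^d` by symmetry)

CITATION HEADER (PLACEMENT v2). This module is part of a certified REPRODUCTION of:
R. Fitzner, R. van der Hofstad, *Mean-field behavior for nearest-neighbor percolation in d > 10*,
Electron. J. Probab. 22 (2017), no. 43, 1–65 [FvdH17], and *Generalized approach to the non-backtracking
lace expansion*, Probab. Theory Related Fields 169 (2017), 1041–1119 [NoBLE17-I] (arXiv:1506.07977, 1506.07969).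
Reproduces: the bookkeeping behind the explicit terms of [NoBLE17-I] §5.3.3 / the notebook `Percolation.nb`
(cells 5–24: the end-point classes `class = (|x|-pattern)`, `|class|`, `c_i(class)`): the `i`-th explicit piece is a
sum over the end-point classes `N` (profiles: `N_j` coordinates of absolute value `j`) of `i`-step self-avoiding
walks, and `c_i` VANISHES on a class unless `‖x‖₁ = Σ_j j·N_j ≤ i` and `i + ‖x‖₁` is even — so the class sum over
the (astronomically large) index set `antidiagonalTuple (i+1) d` is a sum over the short, `d`-independent list of
LIVE profiles, which this module enumerates by structural recursion (kernel-evaluable by `rfl`/`decide` at any fixed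
`i`).  Origin: build `lace`, node N67-S3 (spec `HOME/carver/g18/N67-S-SPEC.md`), census row D10H-3.

## What is here (all `d`-generic; no numerals)

§1 `l1Norm_of_mem_pointClass` — `‖x‖₁ = Σ_j N_j · j` on the class of profile `N`; the class-level vanishing rules
   `card_sawWordsTo_eq_zero_of_mem_pointClass_of_lt` / `_of_odd` / `_of_origin` (`c_i ≡ 0` on a class beyond reach /
   of the wrong parity / at the origin for `i ≥ 1`; from the tree's `sawCount_eq_zero_of_lt` / `_of_odd` via
   `card_sawWordsTo_eq_sawCount`, and the no-return property of self-avoiding words).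
§2 `wsum w l = Σ_j (w + j) · l_j`, `wcomps w b k` — all `l : List ℕ` of length `k` with `wsum w l ≤ b` (structural
   recursion), `mem_wcomps`, `nodup_wcomps`, `wsum_ofFn`.
§3 `consProfile d l i : Fin (i+1) → ℕ` — the profile `(d − Σ l, l_0, …, l_{i−1})` of a multiplicity list, `tailList`,
   and their inverse relations on admissible profiles (`tailList_consProfile`, `consProfile_tailList`,
   `sum_consProfile`, `sum_mul_val_consProfile`).
§4 `liveList d i` — the multiplicity lists `l` (`l_j` coordinates of absolute value `j+1`) of length `i` with
   `Σ_j (j+1) l_j ≤ i`, `i + Σ_j (j+1) l_j` even, `Σ_j l_j ≤ d`, and `Σ_j (j+1) l_j ≠ 0` unless `i = 0` (for `d ≥ 2`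
   exactly the support of `c_i` by classes); `mem_liveList`, `nodup_liveList`;
   **`sum_antidiagonalTuple_eq_sum_liveList`** — for any `Φ` on profiles vanishing on the admissible profiles beyond
   reach, of the wrong parity, or at the origin (order `≥ 1`), `Σ_{N ∈ antidiagonalTuple (i+1) d} Φ N = ((liveList d i).map (l ↦ Φ (consProfile d l i))).sum`
   (`Finset.sum_bij_ne_zero`), and its instance `sum_antidiagonalTuple_eq_sum_liveList_of_sawCount` for summands that
   vanish where `c_i` vanishes on the class.
§5 list-level class data: `sqwsum 1 l = Σ_j j² N_j` (`sum_mul_val_sq_consProfile`, the class weight `‖x‖₂²`) and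
   `card_pointClass_consProfile` (`#class = 2^{Σl} · d(d−1)⋯(d−Σl+1) / ∏ l_j!`, from `card_pointClass_eq_div`);
   `card_sawWordsTo_eq_zero_of_tailList_not_mem` (`c_i ≡ 0` on every admissible class off the live list).
§5b `coordList`, **`canonSite d l`** — the canonical point `(1,…,1,2,…,2,…,0,…,0)` of a multiplicity list
   (definitionally the walk-count tables' `siteOfList (coordList 1 l) d`), its level counts `absCount_canonSite`
   (via the zero-padded-list count `card_filter_univ_getD`) and **`canonSite_mem_pointClass`**: it lies in the class
   of profile `consProfile d l i`; `l1Norm_canonSite`, `card_sawWordsTo_canonSite_eq_zero_of_lt` / `_of_odd` (the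
   sub-cut table atoms below reach / of the wrong parity are `0`).
§6 **`toReal_tsum_sq_weighted_repBubble_le_liveListAtoms`** — the `WBX(M)` cell licence of
   `WeightedBubbleExplicitPieces` (`toReal_tsum_sq_weighted_repBubble_le_classAtoms`) over LIST-INDEXED table atoms:
   hypotheses asked only for `m ≤ i ≤ M` and `l ∈ liveList d i` (class-uniform majorants of `c_i`, `c_r` below the cut,
   `K_{1,L}`), conclusion a finite sum over the live lists with the class cardinality and weight in closed list form —
   the shape a fixed-dimension table cell (N67-S2) discharges entry by entry after evaluating `liveList d i` by `decide`;
   `toReal_tsum_sq_weighted_repBubble_le_liveListAtomsAt` — the same with the majorants asked at ONE representative of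
   each live class (`W_d`-invariance of `c_n` and `K_{n,l}`: `signedPermInvariant_card_sawWordsTo`, `signedPermInvariant_srwK`);
   **`toReal_tsum_sq_weighted_repBubble_le_liveListAtomsCanon`** — the same at the canonical representatives
   `canonSite d l`: every remaining hypothesis is a table lookup (`c_i`, `c_r`) or a closed-form `K_{1,L}` majorant at
   an explicit lattice point.
§7 sanity evaluations of `liveList`, `consProfile`, `coordList`, `canonSite` at tiny orders (kernel `decide` / `rfl`).

## What is NOT here
No walk counts, no table, no cell, no dimension, no instance.  No cited fact, no named hypothesis, no `sorry`.

## References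
* [NoBLE17-I] R. Fitzner, R. van der Hofstad, PTRF 169 (2017) 1041–1119; arXiv:1506.07969 — §5.3.3 (last paragraph).
* [FvdH17] R. Fitzner, R. van der Hofstad, EJP 22 (2017) no. 43; notebook Percolation.nb cells 5–24 (class notation),
  §2.4 (self-avoiding-walk paths).
-/

noncomputable section

namespace Literature.Probability.FitznerVanDerHofstad2017

open _root_.MeasureTheory Finset
open Literature.Barriers.CriticalPhenomena Literature.Probability.Percolation
open Literature.Probability.LatticeModels
open scoped BigOperators ENNReal

variable {d : ℕ}

/-! ### §1. `‖x‖₁` on a class and the class-level vanishing of `c_i` -/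

/-- **`‖x‖₁ = Σ_{j ≤ r} N_j · j` on the class of profile `N`.**
[cite: FitznerVanDerHofstad2016NoBLE, §5.3.3 (the sum over x ∈ ℤ^d regrouped by symmetry)] -/
theorem l1Norm_of_mem_pointClass {r : ℕ} {N : Fin (r + 1) → ℕ} {x : Site d} (hx : x ∈ pointClass d r N) :
    l1Norm x = ∑ j : Fin (r + 1), N j * (j : ℕ) := by
  obtain ⟨hr, hN⟩ := mem_pointClass.1 hx
  unfold l1Norm
  let f : Fin d → Fin (r + 1) := fun μ => ⟨(x μ).natAbs, Nat.lt_succ_of_le (hr μ)⟩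
  rw [← sum_fiberwise_of_maps_to (s := (univ : Finset (Fin d))) (t := (univ : Finset (Fin (r + 1))))
    (g := f) (fun _ _ => mem_univ _) (fun μ => (x μ).natAbs)]
  refine sum_congr rfl fun j _ => ?_
  have hfib : ∀ μ ∈ univ.filter (fun μ => f μ = j), (x μ).natAbs = (j : ℕ) := by
    intro μ hμ
    have h := (mem_filter.1 hμ).2
    rw [← h]
  rw [sum_congr rfl hfib, sum_const, smul_eq_mul, ← hN j]
  unfold absCount
  congr 2
  ext μ
  simp only [mem_filter, mem_univ, true_and, f, Fin.ext_iff]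

/-- **Beyond reach, class level**: `c_i(x) = 0` for every `x` of a class with `Σ_j j·N_j > i`.
[cite: FitznerVanDerHofstad2017, §2.4 (an `i`-step path reaches only `‖x‖₁ ≤ i`)] -/
theorem card_sawWordsTo_eq_zero_of_mem_pointClass_of_lt {i r : ℕ} {N : Fin (r + 1) → ℕ} {x : Site d}
    (hx : x ∈ pointClass d r N) (h : i < ∑ j : Fin (r + 1), N j * (j : ℕ)) : (sawWordsTo d i x).card = 0 := by
  rw [card_sawWordsTo_eq_sawCount]
  exact sawCount_eq_zero_of_lt i x ∅ (by rwa [l1Norm_of_mem_pointClass hx])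

/-- **Parity, class level**: `c_i(x) = 0` for every `x` of a class with `i + Σ_j j·N_j` odd (`ℤ^d` is bipartite).
[cite: FitznerVanDerHofstad2017, §2.4] -/
theorem card_sawWordsTo_eq_zero_of_mem_pointClass_of_odd {i r : ℕ} {N : Fin (r + 1) → ℕ} {x : Site d}
    (hx : x ∈ pointClass d r N) (h : (i + ∑ j : Fin (r + 1), N j * (j : ℕ)) % 2 = 1) :
    (sawWordsTo d i x).card = 0 := by
  rw [card_sawWordsTo_eq_sawCount]
  exact sawCount_eq_zero_of_odd i x ∅ (by rwa [l1Norm_of_mem_pointClass hx])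

/-- No self-avoiding walk of positive length returns to its start: `c_i(0) = 0` for `i ≥ 1` (module-local copy of the
folklore fact). [folklore] -/
private theorem card_sawWordsTo_origin_eq_zero {i : ℕ} (hi : i ≠ 0) : (sawWordsTo d i 0).card = 0 := by
  rw [Finset.card_eq_zero, Finset.eq_empty_iff_forall_notMem]
  intro u hu
  rw [mem_sawWordsTo] at hu
  exact hi (hu.1 0 i (Nat.zero_le _) le_rfl (by rw [hu.2, wordPos_zero])).symm

/-- **At the origin, class level**: `c_i(x) = 0` for every `x` of the class with `Σ_j j·N_j = 0` (i.e. `x = 0`) when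
`i ≥ 1`. [cite: FitznerVanDerHofstad2017, §2.4 (self-avoiding walk paths)] -/
theorem card_sawWordsTo_eq_zero_of_mem_pointClass_of_origin {i r : ℕ} {N : Fin (r + 1) → ℕ} {x : Site d}
    (hx : x ∈ pointClass d r N) (hi : i ≠ 0) (h : ∑ j : Fin (r + 1), N j * (j : ℕ) = 0) :
    (sawWordsTo d i x).card = 0 := by
  rw [← l1Norm_of_mem_pointClass hx] at h
  rw [(l1Norm_eq_zero_iff x).1 h]
  exact card_sawWordsTo_origin_eq_zero hi

/-! ### §2. Weighted compositions: a kernel-evaluable enumeration -/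

/-- The weighted sum `Σ_j (w + j) · l_j` of a multiplicity list (weights `w, w+1, …`). [folklore] -/
def wsum : ℕ → List ℕ → ℕ
  | _, [] => 0
  | w, a :: t => w * a + wsum (w + 1) t

/-- `wsum w [] = 0`. [folklore] -/
@[simp] private theorem wsum_nil (w : ℕ) : wsum w [] = 0 := rfl

/-- `wsum w (a :: t) = w·a + wsum (w+1) t`. [folklore] -/
@[simp] private theorem wsum_cons (w a : ℕ) (t : List ℕ) : wsum w (a :: t) = w * a + wsum (w + 1) t := rfl

/-- All multiplicity lists of length `k` with weighted sum `wsum w l ≤ b` (weights from `w ≥ 1`), by structural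
recursion on the length — kernel-evaluable at fixed arguments. [folklore] -/
def wcomps : ℕ → ℕ → ℕ → List (List ℕ)
  | _, _, 0 => [[]]
  | w, b, k + 1 => (List.range (b / w + 1)).flatMap fun a => (wcomps (w + 1) (b - w * a) k).map (List.cons a)

/-- Membership in `wcomps`: exactly the lists of length `k` with `wsum w l ≤ b` (`w ≥ 1`). [folklore] -/
private theorem mem_wcomps {w b k : ℕ} (hw : 0 < w) {l : List ℕ} : l ∈ wcomps w b k ↔ l.length = k ∧ wsum w l ≤ b := by
  induction k generalizing w b l with
  | zero =>
    simp only [wcomps, List.mem_singleton, List.length_eq_zero_iff]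
    exact ⟨fun h => ⟨h, by subst h; simp⟩, fun h => h.1⟩
  | succ k ih =>
    simp only [wcomps, List.mem_flatMap, List.mem_range, List.mem_map]
    constructor
    · rintro ⟨a, ha, t, ht, rfl⟩
      obtain ⟨hlen, hws⟩ := (ih (w := w + 1) (Nat.succ_pos w)).1 ht
      have hab : w * a ≤ b := by
        rw [mul_comm]; exact (Nat.le_div_iff_mul_le hw).1 (Nat.lt_succ_iff.1 ha)
      exact ⟨by simp [hlen], by rw [wsum_cons]; omega⟩
    · rintro ⟨hlen, hws⟩
      obtain ⟨a, t, rfl⟩ := List.exists_cons_of_length_eq_add_one hlen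
      rw [wsum_cons] at hws
      refine ⟨a, Nat.lt_succ_iff.2 ((Nat.le_div_iff_mul_le hw).2 (by rw [mul_comm]; omega)), t,
        (ih (w := w + 1) (Nat.succ_pos w)).2 ⟨by simpa using hlen, by omega⟩, rfl⟩

/-- `wcomps` has no duplicates. [folklore] -/
private theorem nodup_wcomps (w b k : ℕ) : (wcomps w b k).Nodup := by
  induction k generalizing w b with
  | zero => exact List.nodup_singleton _
  | succ k ih =>
    simp only [wcomps]
    refine List.nodup_flatMap.2 ⟨fun a _ => (ih _ _).map (List.cons_injective), ?_⟩
    refine List.Pairwise.imp (fun {a a'} (hne : a ≠ a') => ?_) List.nodup_range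
    simp only [Function.onFun]
    intro l hl hl'
    obtain ⟨t, -, rfl⟩ := List.mem_map.1 hl
    obtain ⟨t', -, h⟩ := List.mem_map.1 hl'
    exact hne (List.cons.inj h).1.symm

/-- `wsum` of a tabulated list: `wsum w (ofFn f) = Σ_j (w + j) · f j`. [folklore] -/
private theorem wsum_ofFn {k : ℕ} (w : ℕ) (f : Fin k → ℕ) : wsum w (List.ofFn f) = ∑ j : Fin k, (w + (j : ℕ)) * f j := by
  induction k generalizing w with
  | zero => simp
  | succ k ih =>
    rw [List.ofFn_succ, wsum_cons, ih, Fin.sum_univ_succ]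
    simp only [Fin.val_zero, add_zero, Fin.val_succ]
    congr 1
    exact sum_congr rfl fun j _ => by rw [show w + 1 + (j : ℕ) = w + ((j : ℕ) + 1) by ring]

/-! ### §3. Profiles of multiplicity lists -/

/-- The profile `(d − Σ l, l_0, l_1, …, l_{i−1})` of a multiplicity list `l` (`l_j` coordinates of absolute value
`j + 1`; the remaining `d − Σ l` coordinates vanish). [cite: FitznerVanDerHofstad2017, notebook Percolation.nb cells 5–24 (class notation)] -/
def consProfile (d : ℕ) (l : List ℕ) (i : ℕ) : Fin (i + 1) → ℕ :=
  fun j => Fin.cases (d - l.sum) (fun j' : Fin i => l.getD j' 0) j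

/-- The `0`-th entry of the profile of `l` is `d − Σ l`. [folklore] -/
@[simp] private theorem consProfile_zero (d : ℕ) (l : List ℕ) (i : ℕ) : consProfile d l i 0 = d - l.sum := rfl

/-- The `(j+1)`-th entry of the profile of `l` is `l_j`. [folklore] -/
@[simp] private theorem consProfile_succ (d : ℕ) (l : List ℕ) (i : ℕ) (j : Fin i) :
    consProfile d l i j.succ = l.getD j 0 := by
  simp [consProfile]

/-- The multiplicity list `(N_1, …, N_i)` of a profile. [folklore] -/
def tailList {i : ℕ} (N : Fin (i + 1) → ℕ) : List ℕ := List.ofFn fun j : Fin i => N j.succ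

/-- The multiplicity list of a profile of order `i` has length `i`. [folklore] -/
@[simp] private theorem length_tailList {i : ℕ} (N : Fin (i + 1) → ℕ) : (tailList N).length = i := by
  simp [tailList]

/-- `Σ (tailList N) = Σ_{j ≥ 1} N_j`. [folklore] -/
private theorem sum_tailList {i : ℕ} (N : Fin (i + 1) → ℕ) : (tailList N).sum = ∑ j : Fin i, N j.succ := by
  simp [tailList, List.sum_ofFn]

/-- `Σ_j j · N_j = wsum 1 (tailList N)`. [folklore] -/
private theorem sum_mul_val_eq_wsum_tailList {i : ℕ} (N : Fin (i + 1) → ℕ) :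
    ∑ j : Fin (i + 1), N j * (j : ℕ) = wsum 1 (tailList N) := by
  rw [tailList, wsum_ofFn, Fin.sum_univ_succ]
  simp only [Fin.val_zero, mul_zero, zero_add, Fin.val_succ]
  exact sum_congr rfl fun j _ => by ring

/-- `tailList (consProfile d l i) = l` for a list of length `i`. [folklore] -/
private theorem tailList_consProfile (d : ℕ) {i : ℕ} {l : List ℕ} (hl : l.length = i) : tailList (consProfile d l i) = l := by
  subst hl
  refine List.ext_getElem (by simp [tailList]) fun n h₁ h₂ => ?_
  simp only [tailList, List.getElem_ofFn, consProfile_succ]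
  exact List.getD_eq_getElem l 0 h₂

/-- `Σ_j l.getD j 0 = Σ l` over `Fin l.length`-many indices. [folklore] -/
private theorem sum_getD_eq_sum {i : ℕ} {l : List ℕ} (hl : l.length = i) : ∑ j : Fin i, l.getD j 0 = l.sum := by
  have h := sum_tailList (consProfile 0 l i)
  rw [tailList_consProfile 0 hl] at h
  simpa using h.symm

/-- An admissible profile is the profile of its multiplicity list: `consProfile d (tailList N) i = N` when `Σ_j N_j = d`.
[folklore] -/
private theorem consProfile_tailList {i : ℕ} {N : Fin (i + 1) → ℕ} (hN : ∑ j, N j = d) : consProfile d (tailList N) i = N := by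
  funext j
  refine Fin.cases ?_ (fun j' => ?_) j
  · rw [consProfile_zero, sum_tailList]
    rw [Fin.sum_univ_succ] at hN
    omega
  · rw [consProfile_succ, tailList, List.getD_eq_getElem _ _ (by simp), List.getElem_ofFn]

/-- The profile of a list of length `i` with `Σ l ≤ d` is admissible: `Σ_j (consProfile d l i) j = d` (a class of
end points has `d` coordinates in all).
[cite: FitznerVanDerHofstad2017, §2.4 (notebook Percolation.nb cells 5–24, the classes of end points)] -/
theorem sum_consProfile {i : ℕ} {l : List ℕ} (hl : l.length = i) (hsum : l.sum ≤ d) :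
    ∑ j, consProfile d l i j = d := by
  rw [Fin.sum_univ_succ, consProfile_zero]
  simp only [consProfile_succ]
  rw [sum_getD_eq_sum hl]
  omega

/-- `Σ_j j · (consProfile d l i)_j = wsum 1 l`. [folklore] -/
private theorem sum_mul_val_consProfile {i : ℕ} {l : List ℕ} (hl : l.length = i) :
    ∑ j : Fin (i + 1), consProfile d l i j * (j : ℕ) = wsum 1 l := by
  rw [sum_mul_val_eq_wsum_tailList, tailList_consProfile d hl]

/-! ### §4. The live lists and the re-indexing of class sums -/

/-- **The live multiplicity lists of order `i` in dimension `d`**: `l` of length `i` (`l_j` coordinates of absolute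
value `j+1`) with `Σ_j (j+1) l_j ≤ i` (reach), `i + Σ_j (j+1) l_j` even (parity), `Σ_j l_j ≤ d` (at most `d`
non-zero coordinates) and, for `i ≥ 1`, `Σ_j (j+1) l_j ≠ 0` (no self-avoiding walk of positive length returns to the
origin) — by `wcomps` and a filter; kernel-evaluable at fixed `(d, i)`.  For `d ≥ 2` these are exactly the classes
on which `c_i` does not vanish.
[cite: FitznerVanDerHofstad2017, notebook Percolation.nb cells 5–24 (the class tables of the explicit terms)] -/
def liveList (d i : ℕ) : List (List ℕ) :=
  (wcomps 1 i i).filter fun l => l.sum ≤ d ∧ (i + wsum 1 l) % 2 = 0 ∧ (i = 0 ∨ wsum 1 l ≠ 0)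

/-- **Membership in the live list** — the class-support criterion of `c_i`: reach `Σ_j (j+1) l_j ≤ i`, parity, at most
`d` non-zero coordinates, not the origin when `i ≥ 1`.
[cite: FitznerVanDerHofstad2017, §2.4 (self-avoiding walk paths; notebook Percolation.nb cells 5–24, the classes of end points)] -/
theorem mem_liveList {d i : ℕ} {l : List ℕ} :
    l ∈ liveList d i ↔
      l.length = i ∧ wsum 1 l ≤ i ∧ l.sum ≤ d ∧ (i + wsum 1 l) % 2 = 0 ∧ (i = 0 ∨ wsum 1 l ≠ 0) := by
  simp only [liveList, List.mem_filter, mem_wcomps Nat.one_pos, decide_eq_true_eq, and_assoc]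

/-- The live list has no duplicates. [folklore] -/
private theorem nodup_liveList (d i : ℕ) : (liveList d i).Nodup :=
  (nodup_wcomps 1 i i).filter _

/-- **Re-indexing of a class sum by the live list.**  If `Φ` vanishes on every admissible profile beyond reach
(`Σ_j j N_j > i`), of the wrong parity (`i + Σ_j j N_j` odd), or at the origin (`Σ_j j N_j = 0`) when `i ≥ 1`, then
`Σ_{N ∈ antidiagonalTuple (i+1) d} Φ N = Σ_{l ∈ liveList d i} Φ (consProfile d l i)`.
[cite: FitznerVanDerHofstad2016NoBLE, §5.3.3 (the explicit terms as finite sums over end-point classes)]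
[cite: FitznerVanDerHofstad2017, notebook Percolation.nb cells 5–24] -/
theorem sum_antidiagonalTuple_eq_sum_liveList {β : Type*} [AddCommMonoid β] (d i : ℕ)
    (Φ : (Fin (i + 1) → ℕ) → β)
    (hfar : ∀ N ∈ Nat.antidiagonalTuple (i + 1) d, i < ∑ j, N j * (j : ℕ) → Φ N = 0)
    (hodd : ∀ N ∈ Nat.antidiagonalTuple (i + 1) d, (i + ∑ j, N j * (j : ℕ)) % 2 = 1 → Φ N = 0)
    (hzero : ∀ N ∈ Nat.antidiagonalTuple (i + 1) d, i ≠ 0 → ∑ j, N j * (j : ℕ) = 0 → Φ N = 0) :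
    ∑ N ∈ Nat.antidiagonalTuple (i + 1) d, Φ N = ((liveList d i).map fun l => Φ (consProfile d l i)).sum := by
  classical
  rw [← List.sum_toFinset _ (nodup_liveList d i)]
  symm
  refine sum_bij_ne_zero (fun l _ _ => consProfile d l i) (fun l hl _ => ?_) (fun l₁ h₁ _ l₂ h₂ _ h => ?_)
    (fun N hN hΦ => ?_) (fun _ _ _ => rfl)
  · obtain ⟨hlen, -, hsum, -, -⟩ := mem_liveList.1 (List.mem_toFinset.1 hl)
    exact Nat.mem_antidiagonalTuple.2 (sum_consProfile hlen hsum)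
  · have h₁' := (mem_liveList.1 (List.mem_toFinset.1 h₁)).1
    have h₂' := (mem_liveList.1 (List.mem_toFinset.1 h₂)).1
    rw [← tailList_consProfile d h₁', h, tailList_consProfile d h₂']
  · have hNd : ∑ j, N j = d := Nat.mem_antidiagonalTuple.1 hN
    have hreach : ∑ j, N j * (j : ℕ) ≤ i := not_lt.1 fun h => hΦ (hfar N hN h)
    have hpar : (i + ∑ j, N j * (j : ℕ)) % 2 = 0 := by
      rcases Nat.mod_two_eq_zero_or_one (i + ∑ j, N j * (j : ℕ)) with h | h
      · exact h
      · exact absurd (hodd N hN h) hΦ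
    have horig : i = 0 ∨ wsum 1 (tailList N) ≠ 0 := by
      refine (eq_or_ne i 0).imp_right fun hi h0 => hΦ (hzero N hN hi ?_)
      rwa [sum_mul_val_eq_wsum_tailList]
    refine ⟨tailList N, List.mem_toFinset.2 (mem_liveList.2 ⟨length_tailList N, ?_, ?_, ?_, horig⟩), ?_,
      consProfile_tailList hNd⟩
    · rwa [← sum_mul_val_eq_wsum_tailList]
    · rw [sum_tailList]; rw [Fin.sum_univ_succ] at hNd; omega
    · rwa [← sum_mul_val_eq_wsum_tailList]
    · rwa [consProfile_tailList hNd]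

/-- **The class sums of the explicit pieces, re-indexed.**  For summands of the form `F N x` evaluated at a class
member and carrying the factor `c_i` — precisely: `Φ N = 0` whenever `c_i(x) = 0` for all `x ∈ class(N)` — the sum
over all admissible profiles is the sum over the live list:
`Σ_{N ∈ antidiagonalTuple (i+1) d} Φ N = Σ_{l ∈ liveList d i} Φ (consProfile d l i)`.
[cite: FitznerVanDerHofstad2016NoBLE, §5.3.3] [cite: FitznerVanDerHofstad2017, §2.4; notebook Percolation.nb cells 5–24] -/
theorem sum_antidiagonalTuple_eq_sum_liveList_of_sawCount {β : Type*} [AddCommMonoid β] (d i : ℕ)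
    (Φ : (Fin (i + 1) → ℕ) → β)
    (hΦ : ∀ N ∈ Nat.antidiagonalTuple (i + 1) d, (∀ x ∈ pointClass d i N, (sawWordsTo d i x).card = 0) → Φ N = 0) :
    ∑ N ∈ Nat.antidiagonalTuple (i + 1) d, Φ N = ((liveList d i).map fun l => Φ (consProfile d l i)).sum :=
  sum_antidiagonalTuple_eq_sum_liveList d i Φ
    (fun N hN h => hΦ N hN fun _ hx => card_sawWordsTo_eq_zero_of_mem_pointClass_of_lt hx h)
    (fun N hN h => hΦ N hN fun _ hx => card_sawWordsTo_eq_zero_of_mem_pointClass_of_odd hx h)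
    (fun N hN hi h => hΦ N hN fun _ hx => card_sawWordsTo_eq_zero_of_mem_pointClass_of_origin hx hi h)

/-! ### §5. List-level class data: squared weight and class cardinality -/

/-- The squared-weight sum `Σ_j (w + j)² · l_j` of a multiplicity list (weights from `w`): for `w = 1` this is
`‖x‖₂² = Σ_j j² N_j` on the class of profile `consProfile d l i`. [folklore] -/
def sqwsum : ℕ → List ℕ → ℕ
  | _, [] => 0
  | w, a :: t => w ^ 2 * a + sqwsum (w + 1) t

/-- `sqwsum w [] = 0`. [folklore] -/
@[simp] private theorem sqwsum_nil (w : ℕ) : sqwsum w [] = 0 := rfl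

/-- `sqwsum w (a :: t) = w²·a + sqwsum (w+1) t`. [folklore] -/
@[simp] private theorem sqwsum_cons (w a : ℕ) (t : List ℕ) : sqwsum w (a :: t) = w ^ 2 * a + sqwsum (w + 1) t := rfl

/-- `sqwsum w (ofFn f) = Σ_j (w + j)² · f j`. [folklore] -/
private theorem sqwsum_ofFn {k : ℕ} (w : ℕ) (f : Fin k → ℕ) :
    sqwsum w (List.ofFn f) = ∑ j : Fin k, (w + (j : ℕ)) ^ 2 * f j := by
  induction k generalizing w with
  | zero => simp
  | succ k ih =>
    rw [List.ofFn_succ, sqwsum_cons, ih, Fin.sum_univ_succ]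
    simp only [Fin.val_zero, add_zero, Fin.val_succ]
    congr 1
    exact sum_congr rfl fun j _ => by rw [show w + 1 + (j : ℕ) = w + ((j : ℕ) + 1) by ring]

/-- A list of length `i` is the tabulation of its entries: `ofFn (j ↦ l_j) = l`. [folklore] -/
private theorem ofFn_getD_eq {i : ℕ} {l : List ℕ} (hl : l.length = i) : (List.ofFn fun j : Fin i => l.getD j 0) = l := by
  have h := tailList_consProfile 0 hl
  simpa only [tailList, consProfile_succ] using h

/-- **The class weight in list form**: `Σ_j j² · (consProfile d l i)_j = sqwsum 1 l`. [folklore] -/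
private theorem sum_mul_val_sq_consProfile {i : ℕ} {l : List ℕ} (hl : l.length = i) :
    ∑ j : Fin (i + 1), consProfile d l i j * (j : ℕ) ^ 2 = sqwsum 1 l := by
  rw [Fin.sum_univ_succ]
  simp only [Fin.val_zero, ne_eq, OfNat.ofNat_ne_zero, not_false_eq_true, zero_pow, mul_zero, zero_add,
    Fin.val_succ, consProfile_succ]
  conv_rhs => rw [← ofFn_getD_eq hl, sqwsum_ofFn]
  exact sum_congr rfl fun j _ => by ring

/-- `∏_j (consProfile d l i)_{j+1}! = ∏_j l_j!`. [folklore] -/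
private theorem prod_factorial_consProfile {i : ℕ} {l : List ℕ} (hl : l.length = i) :
    ∏ j : Fin i, (consProfile d l i j.succ).factorial = (l.map Nat.factorial).prod := by
  simp only [consProfile_succ]
  rw [← List.prod_ofFn, ← ofFn_getD_eq hl, List.map_ofFn, ofFn_getD_eq hl]
  rfl

/-- **The class cardinality in list form**: `#class(consProfile d l i) = 2^{Σ l} · d(d−1)⋯(d−Σ l+1) / ∏_j l_j!`
(`card_pointClass_eq_div`). [cite: FitznerVanDerHofstad2017, notebook Percolation.nb cells 5–24 (`|class|`)] -/
theorem card_pointClass_consProfile {i : ℕ} {l : List ℕ} (hl : l.length = i) (hsum : l.sum ≤ d) :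
    (pointClass d i (consProfile d l i)).card = 2 ^ l.sum * d.descFactorial l.sum / (l.map Nat.factorial).prod := by
  rw [card_pointClass_eq_div _ (sum_consProfile hl hsum), consProfile_zero, Nat.sub_sub_self hsum,
    prod_factorial_consProfile hl]

/-- **Off the live list, `c_i` vanishes on the class**: if `N` is admissible and its multiplicity list is not live,
then `c_i(x) = 0` for every `x ∈ class(N)`. [cite: FitznerVanDerHofstad2017, §2.4] -/
theorem card_sawWordsTo_eq_zero_of_tailList_not_mem {i : ℕ} {N : Fin (i + 1) → ℕ}
    (hN : N ∈ Nat.antidiagonalTuple (i + 1) d) (hl : tailList N ∉ liveList d i) {x : Site d}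
    (hx : x ∈ pointClass d i N) : (sawWordsTo d i x).card = 0 := by
  have hNd : ∑ j, N j = d := Nat.mem_antidiagonalTuple.1 hN
  have hsum : (tailList N).sum ≤ d := by rw [sum_tailList]; rw [Fin.sum_univ_succ] at hNd; omega
  by_cases hreach : wsum 1 (tailList N) ≤ i
  · by_cases hpar : (i + wsum 1 (tailList N)) % 2 = 0
    · by_cases horig : i = 0 ∨ wsum 1 (tailList N) ≠ 0
      · exact absurd (mem_liveList.2 ⟨length_tailList N, hreach, hsum, hpar, horig⟩) hl
      · rw [not_or, not_ne_iff] at horig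
        exact card_sawWordsTo_eq_zero_of_mem_pointClass_of_origin hx horig.1
          (by rw [sum_mul_val_eq_wsum_tailList]; exact horig.2)
    · exact card_sawWordsTo_eq_zero_of_mem_pointClass_of_odd hx
        (by rw [sum_mul_val_eq_wsum_tailList]; omega)
  · exact card_sawWordsTo_eq_zero_of_mem_pointClass_of_lt hx (by rw [sum_mul_val_eq_wsum_tailList]; omega)

/-! ### §5b. A canonical representative of each live class -/

/-- The ascending coordinate list of a multiplicity list read from absolute value `w`: `l₀` entries `w`, then `l₁`
entries `w + 1`, and so on (`coordList 1 [1, 2] = [1, 2, 2]`, the end-point convention of the walk-count tables).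
[folklore] -/
def coordList : ℕ → List ℕ → List ℤ
  | _, [] => []
  | w, a :: t => List.replicate a (w : ℤ) ++ coordList (w + 1) t

/-- `coordList w [] = []`. [folklore] -/
@[simp] private theorem coordList_nil (w : ℕ) : coordList w [] = [] := rfl

/-- `coordList w (a :: t) = replicate a w ++ coordList (w+1) t`. [folklore] -/
@[simp] private theorem coordList_cons (w a : ℕ) (t : List ℕ) :
    coordList w (a :: t) = List.replicate a (w : ℤ) ++ coordList (w + 1) t := rfl

/-- `coordList w l` has `Σ l` entries. [folklore] -/
private theorem length_coordList (w : ℕ) (l : List ℕ) : (coordList w l).length = l.sum := by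
  induction l generalizing w with
  | nil => simp
  | cons a t ih => simp [ih]

/-- The number of entries of `coordList w l` (`w ≥ 1`) of absolute value `j` is `l_{j-w}` (`0` if `j < w`).
[folklore] -/
private theorem countP_natAbs_coordList {w : ℕ} (hw : 0 < w) (l : List ℕ) (j : ℕ) :
    (coordList w l).countP (fun a => a.natAbs = j) = if w ≤ j then l.getD (j - w) 0 else 0 := by
  induction l generalizing w with
  | nil => simp
  | cons a t ih =>
    rw [coordList_cons, List.countP_append, List.countP_replicate, ih (Nat.lt_succ_of_lt hw)]
    simp only [Int.natAbs_natCast, decide_eq_true_eq]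
    rcases lt_trichotomy j w with hj | rfl | hj
    · rw [if_neg (Nat.ne_of_lt hj).symm, if_neg (by omega), if_neg (by omega)]
    · simp
    · obtain ⟨k, rfl⟩ := Nat.exists_eq_add_of_lt hj
      rw [if_neg (by omega), if_pos (by omega), if_pos (by omega), zero_add,
        show w + k + 1 - w = k + 1 by omega, show w + k + 1 - (w + 1) = k by omega, List.getD_cons_succ]

/-- Counting the coordinates `μ < d` at which a zero-padded list satisfies a predicate. [folklore] -/
private theorem card_filter_univ_getD {α : Type*} (P : α → Prop) [DecidablePred P] (a₀ : α) :
    ∀ (d : ℕ) (L : List α), #(univ.filter fun μ : Fin d => P (L.getD μ a₀)) =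
      (L.take d).countP (fun a => P a) + (if P a₀ then d - L.length else 0)
  | 0, L => by simp
  | d + 1, [] => by
    have ih := card_filter_univ_getD P a₀ d []
    simp only [List.getD_nil, List.take_nil, List.countP_nil, List.length_nil, Nat.sub_zero,
      zero_add] at ih ⊢
    rw [Fin.card_filter_univ_succ', ih]
    split_ifs <;> simp [add_comm]
  | d + 1, a :: L => by
    have ih := card_filter_univ_getD P a₀ d L
    rw [Fin.card_filter_univ_succ']
    simp only [Fin.val_zero, List.getD_cons_zero, Fin.val_succ, List.getD_cons_succ, ih,
      List.take_succ_cons, List.countP_cons, List.length_cons, Nat.add_sub_add_right, decide_eq_true_eq]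
    ring

/-- **The canonical point of a multiplicity list**: coordinates `coordList 1 l` padded with zeros — the point
`(1,…,1,2,…,2,…,0,…,0)` with `l_j` coordinates equal to `j+1`; definitionally the tables' `siteOfList (coordList 1 l) d`.
[cite: FitznerVanDerHofstad2016NoBLE, §5.3.3 p. 1098 (one representative per class of end points)] -/
def canonSite (d : ℕ) (l : List ℕ) : Site d := fun μ => (coordList 1 l).getD μ 0

/-- The level counts of the canonical point: `l_{j-1}` coordinates of absolute value `j ≥ 1`, and `d − Σ l` zero
coordinates (when `Σ l ≤ d`).
[cite: FitznerVanDerHofstad2016NoBLE, §5.3.3 p. 1098 (one representative per class of end points)] -/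
theorem absCount_canonSite {l : List ℕ} (hsum : l.sum ≤ d) (j : ℕ) :
    absCount (canonSite d l) j = if j = 0 then d - l.sum else l.getD (j - 1) 0 := by
  have h := card_filter_univ_getD (fun a : ℤ => a.natAbs = j) 0 d (coordList 1 l)
  rw [List.take_of_length_le (by rw [length_coordList]; exact hsum), countP_natAbs_coordList Nat.one_pos,
    length_coordList] at h
  change #(univ.filter fun μ : Fin d => ((coordList 1 l).getD μ 0).natAbs = j) = _
  rw [h]
  by_cases hj : j = 0
  · subst hj; simp
  · simp [hj, Ne.symm hj, Nat.one_le_iff_ne_zero.2 hj]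

/-- **The canonical point lies in its class**: for `l` of length `i` with `Σ l ≤ d`,
`canonSite d l ∈ pointClass d i (consProfile d l i)`.
[cite: FitznerVanDerHofstad2016NoBLE, §5.3.3 p. 1098 (one representative per class of end points)] -/
theorem canonSite_mem_pointClass {i : ℕ} {l : List ℕ} (hl : l.length = i) (hsum : l.sum ≤ d) :
    canonSite d l ∈ pointClass d i (consProfile d l i) := by
  rw [mem_pointClass_iff (sum_consProfile hl hsum)]
  intro j
  rw [absCount_canonSite hsum]
  refine Fin.cases ?_ (fun j' => ?_) j
  · simp
  · simp

/-- `‖canonSite d l‖₁ = Σ_j (j+1) l_j` (`= wsum 1 l`) when `Σ l ≤ d`.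
[cite: FitznerVanDerHofstad2016NoBLE, §5.3.3 p. 1098 (one representative per class of end points)] -/
theorem l1Norm_canonSite {l : List ℕ} (hsum : l.sum ≤ d) : l1Norm (canonSite d l) = wsum 1 l := by
  rw [l1Norm_of_mem_pointClass (canonSite_mem_pointClass rfl hsum), sum_mul_val_consProfile rfl]

/-- **Below reach at the canonical point**: `c_r(canonSite d l) = 0` for `r < Σ_j (j+1) l_j` — the table atom of a
sub-cut order below `‖x‖₁` is `0` (kernel: `wsum 1 l` evaluates by `decide`).
[cite: FitznerVanDerHofstad2017, §2.4 (self-avoiding walk paths: no walk shorter than `‖x‖₁` reaches `x`)] -/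
theorem card_sawWordsTo_canonSite_eq_zero_of_lt {l : List ℕ} (hsum : l.sum ≤ d) {r : ℕ} (h : r < wsum 1 l) :
    (sawWordsTo d r (canonSite d l)).card = 0 :=
  card_sawWordsTo_eq_zero_of_mem_pointClass_of_lt (canonSite_mem_pointClass rfl hsum)
    (by rwa [sum_mul_val_consProfile rfl])

/-- **Wrong parity at the canonical point**: `c_r(canonSite d l) = 0` when `r + Σ_j (j+1) l_j` is odd.
[cite: FitznerVanDerHofstad2017, §2.4 (self-avoiding walk paths: parity of `‖x‖₁`)] -/
theorem card_sawWordsTo_canonSite_eq_zero_of_odd {l : List ℕ} (hsum : l.sum ≤ d) {r : ℕ}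
    (h : (r + wsum 1 l) % 2 = 1) : (sawWordsTo d r (canonSite d l)).card = 0 :=
  card_sawWordsTo_eq_zero_of_mem_pointClass_of_odd (canonSite_mem_pointClass rfl hsum)
    (by rwa [sum_mul_val_consProfile rfl])

/-! ### §6. The `WBX(M)` cell licence over LIST-INDEXED table atoms -/

variable {ι : Type*} [Fintype ι] [Nonempty ι]

/-- **The `WBX(M)` cell licence over list-indexed table atoms** (the form a fixed-dimension table cell reads; N67-S3
part 1b).  On the bootstrap window `p ∈ (1/(2d−1), p_c)` with `f_i(p) ≤ Γ_i`, `𝒮 k = (1, M+1, {0})`, `c > 0`, `d ≥ 3`: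
for per-entry cuts `L_{i,l}`, any `z ≥ p`, and reals `C_{i,l}`, `b_{i,l,r} ≥ 0`, `K_{i,l}` dominating `c_i(x)`,
`c_r(x)` (`r < L_{i,l}`) and `K_{1,L_{i,l}}(x)` for every point `x` of the class of `consProfile d l i`, asked ONLY for
the orders `m ≤ i ≤ M` and the entries `l` of the live list `liveList d i`,
`(Σ_y ‖y‖₂² P_p({0 ←m→ y} ∘ {y ↔ 0})).toReal ≤ Σ_{i=m}^{M} z^i Σ_{l ∈ liveList d i} (2^{Σl} d^{(Σl)}/∏ l_j!) · C_{i,l} ·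
  sqwsum 1 l · [ Σ_{r<L_{i,l}} z^r b_{i,l,r} + (2dz)^{L_{i,l}} ((2d−2)/(2d−1) Γ₂) K_{i,l} ] + (2dz)^{M+1} Γ₃ c_k`
(`Γ₂ = Γ 1`, `Γ₃ = Γ 2`; from `toReal_tsum_sq_weighted_repBubble_le_classAtoms` at internally chosen
representatives, the classes off the live list contributing `0` by `card_sawWordsTo_eq_zero_of_tailList_not_mem`,
and the class sums re-indexed by `sum_antidiagonalTuple_eq_sum_liveList`).
[cite: FitznerVanDerHofstad2016NoBLE, §5.3.1 (5.36)–(5.38), §5.3.2 (first display) p. 1097, §5.3.3 (last paragraph) p. 1098, (2.6)–(2.7), (2.9)]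
[cite: FitznerVanDerHofstad2017, (2.19)–(2.21), §4.2 (4.3), (4.18); notebook Percolation.nb cells 5–24, cell 15 `Bound[WeightedBubble,k,s]`] -/
theorem toReal_tsum_sq_weighted_repBubble_le_liveListAtoms (hd : 3 ≤ d) {p : unitInterval}
    (hp : p ∈ Set.Ioo (nbwThresholdI d) (criticalProbI d)) (m M : ℕ)
    {𝒮 : ι → ℕ × ℕ × Set (Site d)} {cμ : ℝ} {c : ι → ℝ} (hc : ∀ k, 0 < c k) {Γ : Fin 3 → ℝ}
    (hΓ : ∀ i, nobleFOf 𝒮 cμ c i p ≤ Γ i) {k : ι} (hk : 𝒮 k = (1, M + 1, {(0 : Site d)}))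
    (L : ℕ → List ℕ → ℕ) {z : ℝ} (hpz : (p : ℝ) ≤ z)
    {C : ℕ → List ℕ → ℝ}
    (hC : ∀ i ∈ Icc m M, ∀ l ∈ liveList d i, ∀ x ∈ pointClass d i (consProfile d l i),
      ((sawWordsTo d i x).card : ℝ) ≤ C i l)
    {b : ℕ → List ℕ → ℕ → ℝ}
    (hb : ∀ i ∈ Icc m M, ∀ l ∈ liveList d i, ∀ x ∈ pointClass d i (consProfile d l i), ∀ r, r < L i l →
      ((sawWordsTo d r x).card : ℝ) ≤ b i l r)
    (hb0 : ∀ i ∈ Icc m M, ∀ l ∈ liveList d i, ∀ r, r < L i l → 0 ≤ b i l r)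
    {K : ℕ → List ℕ → ℝ}
    (hK : ∀ i ∈ Icc m M, ∀ l ∈ liveList d i, ∀ x ∈ pointClass d i (consProfile d l i),
      srwK d 1 (L i l) x ≤ K i l) :
    (∑' y : Site d, ENNReal.ofReal (euclidNorm y ^ 2) *
        bondPercolation (zdGraph d) p (openConnGe m (0 : Site d) y □ openConn y 0)).toReal ≤
      (∑ i ∈ Icc m M, z ^ i *
          ((liveList d i).map fun l =>
            ((2 ^ l.sum * d.descFactorial l.sum / (l.map Nat.factorial).prod : ℕ) : ℝ) *
              (C i l * ((sqwsum 1 l : ℝ) *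
                ((∑ r ∈ range (L i l), z ^ r * b i l r) +
                  (2 * d * z) ^ (L i l) * ((2 * d - 2) / (2 * d - 1) * Γ 1) * K i l)))).sum) +
        (2 * d * z) ^ (M + 1) * (Γ 2 * c k) := by
  classical
  -- a member of every admissible class (the representatives)
  have hx : ∀ i, ∀ N ∈ Nat.antidiagonalTuple (i + 1) d, ∃ x, x ∈ pointClass d i N :=
    fun i N hN => pointClass_nonempty (r := i) (Nat.mem_antidiagonalTuple.1 hN)
  let rep : (i : ℕ) → (Fin (i + 1) → ℕ) → Site d := fun i N =>
    if h : N ∈ Nat.antidiagonalTuple (i + 1) d then (hx i N h).choose else 0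
  have hmem : ∀ i, ∀ N ∈ Nat.antidiagonalTuple (i + 1) d, rep i N ∈ pointClass d i N := fun i N hN => by
    simp only [rep, dif_pos hN]
    exact (hx i N hN).choose_spec
  have hrep : ∀ i, ∀ N ∈ Nat.antidiagonalTuple (i + 1) d, (pointClass d i N).Nonempty →
      rep i N ∈ pointClass d i N := fun i N hN _ => hmem i N hN
  -- a live admissible profile is the profile of its (live) multiplicity list
  have hcls : ∀ i, ∀ N ∈ Nat.antidiagonalTuple (i + 1) d,
      pointClass d i (consProfile d (tailList N) i) = pointClass d i N := fun i N hN => by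
    rw [consProfile_tailList (Nat.mem_antidiagonalTuple.1 hN)]
  -- the N-level atoms: the list atoms on the live classes, the trivial ones (cut 0, count 0) off them
  have hA := toReal_tsum_sq_weighted_repBubble_le_classAtoms hd hp m M hc hΓ hk rep hrep
    (fun i N => if tailList N ∈ liveList d i then L i (tailList N) else 0) hpz
    (C := fun i N => if tailList N ∈ liveList d i then C i (tailList N) else 0)
    (fun i hi N hN => by
      by_cases hl : tailList N ∈ liveList d i
      · simp only [if_pos hl]
        exact hC i hi _ hl _ (by rw [hcls i N hN]; exact hmem i N hN)
      · simp only [if_neg hl, card_sawWordsTo_eq_zero_of_tailList_not_mem hN hl (hmem i N hN), Nat.cast_zero,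
          le_refl])
    (b := fun i N r => if tailList N ∈ liveList d i then b i (tailList N) r else 0)
    (fun i hi N hN r hr => by
      by_cases hl : tailList N ∈ liveList d i
      · simp only [if_pos hl] at hr ⊢
        exact hb i hi _ hl _ (by rw [hcls i N hN]; exact hmem i N hN) r hr
      · simp only [if_neg hl] at hr
        exact absurd hr (Nat.not_lt_zero r))
    (fun i hi N hN r hr => by
      by_cases hl : tailList N ∈ liveList d i
      · simp only [if_pos hl] at hr ⊢
        exact hb0 i hi _ hl r hr
      · simp only [if_neg hl] at hr
        exact absurd hr (Nat.not_lt_zero r))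
    (K := fun i N => if tailList N ∈ liveList d i then K i (tailList N) else srwK d 1 0 (rep i N))
    (fun i hi N hN => by
      by_cases hl : tailList N ∈ liveList d i
      · simp only [if_pos hl]
        exact hK i hi _ hl _ (by rw [hcls i N hN]; exact hmem i N hN)
      · simp only [if_neg hl, le_refl])
  refine hA.trans (le_of_eq ?_)
  congr 1
  refine sum_congr rfl fun i hi => ?_
  congr 1
  -- re-index the class sum of order `i` by the live list
  rw [sum_antidiagonalTuple_eq_sum_liveList d i _ ?hfar ?hodd ?hzero]
  rotate_left
  · intro N hN hlt
    have hl : tailList N ∉ liveList d i := fun hl => by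
      have h := (mem_liveList.1 hl).2.1
      rw [← sum_mul_val_eq_wsum_tailList] at h
      omega
    simp only [if_neg hl, zero_mul, mul_zero]
  · intro N hN hodd'
    have hl : tailList N ∉ liveList d i := fun hl => by
      have h := (mem_liveList.1 hl).2.2.2.1
      rw [← sum_mul_val_eq_wsum_tailList] at h
      omega
    simp only [if_neg hl, zero_mul, mul_zero]
  · intro N hN hi h0
    have hl : tailList N ∉ liveList d i := fun hl => by
      have h := (mem_liveList.1 hl).2.2.2.2
      rw [← sum_mul_val_eq_wsum_tailList] at h
      omega
    simp only [if_neg hl, zero_mul, mul_zero]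
  · refine congrArg List.sum (List.map_congr_left fun l hl => ?_)
    have hlen : l.length = i := (mem_liveList.1 hl).1
    have hsum : l.sum ≤ d := (mem_liveList.1 hl).2.2.1
    have hN : consProfile d l i ∈ Nat.antidiagonalTuple (i + 1) d :=
      Nat.mem_antidiagonalTuple.2 (sum_consProfile hlen hsum)
    simp only [tailList_consProfile d hlen, if_pos hl]
    rw [card_pointClass_consProfile hlen hsum, euclidNorm_sq_of_mem_pointClass (hmem i _ hN),
      sum_mul_val_sq_consProfile hlen]

/-- `x ↦ K_{n,l}(x)` is a `W_d`-invariant function (the symmetrised `D̂^{(x)}` is orbit-invariant, `DhatSym_spAct`).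
[cite: FitznerVanDerHofstad2016NoBLE, (3.36) p. 1071] -/
theorem signedPermInvariant_srwK (n l : ℕ) : SignedPermInvariant (fun x : Site d => srwK d n l x) := by
  intro π ε x
  have h : spAct ((π.symm, ε) : SgnPermPair d) x = Site.signedPerm π ε x := by
    rw [spAct_eq_signedPerm]; simp
  show srwK d n l (Site.signedPerm π ε x) = srwK d n l x
  rw [← h]
  unfold srwK
  simp_rw [DhatSym_spAct]

/-- **The `WBX(M)` cell licence over list-indexed table atoms AT REPRESENTATIVES** — the same as
`toReal_tsum_sq_weighted_repBubble_le_liveListAtoms` with the majorants asked at ONE point `x_{i,l}` of each live class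
(`x_{i,l} ∈ class(consProfile d l i)`, e.g. by `mem_pointClass` and `decide` at fixed `d`): `c_i`, `c_r` and `K_{1,L}`
are `W_d`-invariant (`signedPermInvariant_card_sawWordsTo`, `signedPermInvariant_srwK`), so a bound at one point of a
class is a bound on the class.
[cite: FitznerVanDerHofstad2016NoBLE, §5.3.1 (5.36)–(5.38), §5.3.2 (first display) p. 1097, §5.3.3 (last paragraph) p. 1098, (2.6)–(2.7), (2.9), (3.36)]
[cite: FitznerVanDerHofstad2017, (2.19)–(2.21), §4.2 (4.3), (4.18); notebook Percolation.nb cells 5–24, cell 15 `Bound[WeightedBubble,k,s]`] -/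
theorem toReal_tsum_sq_weighted_repBubble_le_liveListAtomsAt (hd : 3 ≤ d) {p : unitInterval}
    (hp : p ∈ Set.Ioo (nbwThresholdI d) (criticalProbI d)) (m M : ℕ)
    {𝒮 : ι → ℕ × ℕ × Set (Site d)} {cμ : ℝ} {c : ι → ℝ} (hc : ∀ k, 0 < c k) {Γ : Fin 3 → ℝ}
    (hΓ : ∀ i, nobleFOf 𝒮 cμ c i p ≤ Γ i) {k : ι} (hk : 𝒮 k = (1, M + 1, {(0 : Site d)}))
    (rep : ℕ → List ℕ → Site d)
    (hrep : ∀ i ∈ Icc m M, ∀ l ∈ liveList d i, rep i l ∈ pointClass d i (consProfile d l i))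
    (L : ℕ → List ℕ → ℕ) {z : ℝ} (hpz : (p : ℝ) ≤ z)
    {C : ℕ → List ℕ → ℝ}
    (hC : ∀ i ∈ Icc m M, ∀ l ∈ liveList d i, ((sawWordsTo d i (rep i l)).card : ℝ) ≤ C i l)
    {b : ℕ → List ℕ → ℕ → ℝ}
    (hb : ∀ i ∈ Icc m M, ∀ l ∈ liveList d i, ∀ r, r < L i l → ((sawWordsTo d r (rep i l)).card : ℝ) ≤ b i l r)
    (hb0 : ∀ i ∈ Icc m M, ∀ l ∈ liveList d i, ∀ r, r < L i l → 0 ≤ b i l r)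
    {K : ℕ → List ℕ → ℝ}
    (hK : ∀ i ∈ Icc m M, ∀ l ∈ liveList d i, srwK d 1 (L i l) (rep i l) ≤ K i l) :
    (∑' y : Site d, ENNReal.ofReal (euclidNorm y ^ 2) *
        bondPercolation (zdGraph d) p (openConnGe m (0 : Site d) y □ openConn y 0)).toReal ≤
      (∑ i ∈ Icc m M, z ^ i *
          ((liveList d i).map fun l =>
            ((2 ^ l.sum * d.descFactorial l.sum / (l.map Nat.factorial).prod : ℕ) : ℝ) *
              (C i l * ((sqwsum 1 l : ℝ) *
                ((∑ r ∈ range (L i l), z ^ r * b i l r) +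
                  (2 * d * z) ^ (L i l) * ((2 * d - 2) / (2 * d - 1) * Γ 1) * K i l)))).sum) +
        (2 * d * z) ^ (M + 1) * (Γ 2 * c k) :=
  toReal_tsum_sq_weighted_repBubble_le_liveListAtoms hd hp m M hc hΓ hk L hpz
    (fun i hi l hl x hx => by
      have h := (signedPermInvariant_card_sawWordsTo (d := d) i).eq_of_mem_pointClass hx (hrep i hi l hl)
      rw [h]; exact hC i hi l hl)
    (fun i hi l hl x hx r hr => by
      have h := (signedPermInvariant_card_sawWordsTo (d := d) r).eq_of_mem_pointClass hx (hrep i hi l hl)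
      rw [h]; exact hb i hi l hl r hr)
    hb0
    (fun i hi l hl x hx => by
      have h := (signedPermInvariant_srwK (d := d) 1 (L i l)).eq_of_mem_pointClass hx (hrep i hi l hl)
      rw [h]; exact hK i hi l hl)

/-- **The `WBX(M)` cell over list-indexed table atoms at the CANONICAL representatives.**  The statement of
`toReal_tsum_sq_weighted_repBubble_le_liveListAtomsAt` with `rep i l := canonSite d l`: the table atoms are asked at
the points `canonSite d l` (by `rfl` the tables' `siteOfList (coordList 1 l) d`), one per live class and order
`i ∈ [m, M]`, and no class-membership certificate is left to the consumer (`canonSite_mem_pointClass`).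
[cite: FitznerVanDerHofstad2016NoBLE, §5.3.1 (5.36)–(5.38) with §5.3.3 p. 1098; FitznerVanDerHofstad2017, §4.2 (4.18)] -/
theorem toReal_tsum_sq_weighted_repBubble_le_liveListAtomsCanon (hd : 3 ≤ d) {p : unitInterval}
    (hp : p ∈ Set.Ioo (nbwThresholdI d) (criticalProbI d)) (m M : ℕ)
    {𝒮 : ι → ℕ × ℕ × Set (Site d)} {cμ : ℝ} {c : ι → ℝ} (hc : ∀ k, 0 < c k) {Γ : Fin 3 → ℝ}
    (hΓ : ∀ i, nobleFOf 𝒮 cμ c i p ≤ Γ i) {k : ι} (hk : 𝒮 k = (1, M + 1, {(0 : Site d)}))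
    (L : ℕ → List ℕ → ℕ) {z : ℝ} (hpz : (p : ℝ) ≤ z)
    {C : ℕ → List ℕ → ℝ}
    (hC : ∀ i ∈ Icc m M, ∀ l ∈ liveList d i, ((sawWordsTo d i (canonSite d l)).card : ℝ) ≤ C i l)
    {b : ℕ → List ℕ → ℕ → ℝ}
    (hb : ∀ i ∈ Icc m M, ∀ l ∈ liveList d i, ∀ r, r < L i l →
      ((sawWordsTo d r (canonSite d l)).card : ℝ) ≤ b i l r)
    (hb0 : ∀ i ∈ Icc m M, ∀ l ∈ liveList d i, ∀ r, r < L i l → 0 ≤ b i l r)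
    {K : ℕ → List ℕ → ℝ}
    (hK : ∀ i ∈ Icc m M, ∀ l ∈ liveList d i, srwK d 1 (L i l) (canonSite d l) ≤ K i l) :
    (∑' y : Site d, ENNReal.ofReal (euclidNorm y ^ 2) *
        bondPercolation (zdGraph d) p (openConnGe m (0 : Site d) y □ openConn y 0)).toReal ≤
      (∑ i ∈ Icc m M, z ^ i *
          ((liveList d i).map fun l =>
            ((2 ^ l.sum * d.descFactorial l.sum / (l.map Nat.factorial).prod : ℕ) : ℝ) *
              (C i l * ((sqwsum 1 l : ℝ) *
                ((∑ r ∈ range (L i l), z ^ r * b i l r) +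
                  (2 * d * z) ^ (L i l) * ((2 * d - 2) / (2 * d - 1) * Γ 1) * K i l)))).sum) +
        (2 * d * z) ^ (M + 1) * (Γ 2 * c k) :=
  toReal_tsum_sq_weighted_repBubble_le_liveListAtomsAt hd hp m M hc hΓ hk (fun _ l => canonSite d l)
    (fun _ _ _ hl => canonSite_mem_pointClass (mem_liveList.1 hl).1 (mem_liveList.1 hl).2.2.1) L hpz hC hb hb0 hK

/-! ### §7. Sanity evaluations (kernel, `decide`; tiny orders only) -/

/-- The live lists of orders `0, 1, 2, 3` (any `d ≥ 3`): `[[]]`, `[[1]]`, `[[0,1],[2,0]]`,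
`[[0,0,1],[1,0,0],[1,1,0],[3,0,0]]`; order `4` has `7` entries. [folklore] -/
example : liveList 5 0 = [[]] := by decide
example : liveList 5 1 = [[1]] := by decide
example : liveList 5 2 = [[0, 1], [2, 0]] := by decide
example : liveList 7 3 = [[0, 0, 1], [1, 0, 0], [1, 1, 0], [3, 0, 0]] := by decide
example : (liveList 7 4).length = 7 := by decide

/-- The consumer's path for one live entry (order `3`, list `[1,1,0]`: one coordinate `±1`, one `±2`), in a toy
dimension: the profile, the class cardinality `2² · 7 · 6 = 168` and the class weight `1 + 4 = 5` evaluate by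
`decide` (a representative is certified by `mem_pointClass_iff` at fixed dimension). [folklore] -/
example : consProfile 7 [1, 1, 0] 3 = ![5, 1, 1, 0] := by decide
example : (2 ^ [1, 1, 0].sum * (7 : ℕ).descFactorial [1, 1, 0].sum / (([1, 1, 0] : List ℕ).map Nat.factorial).prod
    : ℕ) = 168 := by decide
example : sqwsum 1 [1, 1, 0] = 5 := by decide
example : coordList 1 [1, 1, 0] = [1, 2] := by decide
example : canonSite 7 [1, 1, 0] = fun μ : Fin 7 => [(1 : ℤ), 2].getD μ 0 := rfl

end Literature.Probability.FitznerVanDerHofstad2017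

end
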